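import Summits.Ventures.Crystal3D.Theorems.StickyWulffConstantCoaxialWallLawReflectionWordsFrame
import Summits.Ventures.Crystal3D.Theorems.StickyWulffConstantCoaxialWallLawHealCap
import HarnessLib

/-!
# The covering radius of the close-packed dozen is 45°: every direction is within 45° of a slot, on the right side of any twin plane
# (crux `GenericWallFloor`, stmt-Ventures-19480, kernel G; first brick of TRACK 2′ = the structural proof of the LAYER ROWS input `HRowEndFarApart`;
#  machine owner 19480-p2 g14, 2026-08-29)

HONEST FRAMING. Venture `Summits/Ventures/Crystal3D` (cell `crystal3d-full`), route `route-Ventures-StickyWulffConstant`, helper for the crux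
`GenericWallFloor` (stmt-Ventures-19480) / consumer `TextureLiminfV5` (stmt-Ventures-23912).  Elementary geometry of the twelve slots in cubic
coordinates (`cubicCoords`, `slotSite`, `ReflWord.nrmVec`); standard axioms; nothing about configurations; F-C1 not moved.

THE POINT.  The √2-gap around a completely kissed ball (next file) rests on ONE fact about the cuboctahedron `fccSlots`: its vertices cover the unit sphere
with caps of angular radius 45° — every unit `v` has a slot `s` with `⟪v, s⟫ ≥ √2/2` — and, for the TWIN (anticuboctahedral) dozens, the witness can
be taken on the non-negative side of any `{111}` normal `μ` with `⟪v, μ⟫ ≥ 0`.  In cubic coordinates `v = (a,b,c)`, `a²+b²+c² = 1`, the slots are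
`(±1,±1,0)/√2` and permutations, so `⟪v, s⟫·√2` ranges over `±a±b, ±a±c, ±b±c`; the key inequality is `max(|a|+|b|, |a|+|c|, |b|+|c|) ≥ 1`
(`2|ab| < c²`, `2|ac| < b²`, `2|bc| < a²` cannot all hold), and the witness `(sgn a, sgn b, 0)` lies on the non-negative side of `μ = (ε₀,ε₁,ε₂)/√3`
unless `ε₀a = −|a|`, `ε₁b = −|b|`, which `⟪v, μ⟫ ≥ 0` forbids (`|c| ≥ |a|+|b| ≥ 1` forces `a = b = 0`).
* `exists_pair_abs_add_ge_one` — the key inequality; `exists_slotInt_pair` — the slot with prescribed signs on a prescribed coordinate pair (table);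
* **`exists_slot_cover_nonneg`** — for unit `v`, a unit model menu normal `μ` with `⟪v, μ⟫ ≥ 0`: a slot `s` with `⟪s, μ⟫ ≥ 0` and `⟪v, s⟫ ≥ √2/2`;
* **`exists_slot_cover`** — for unit `v`: a slot `s` with `⟪v, s⟫ ≥ √2/2`.
WHAT THIS IS NOT: nothing about packings yet; F-C1 not moved.
-/

noncomputable section

namespace Summit.Ventures.Crystal3D.Theorems

open Finset NearIdentity ReflWord
open scoped InnerProductSpace Matrix

/-! ### The key inequality -/

/-- **Among `|a|+|b|, |a|+|c|, |b|+|c|` one is at least `1`** when `a² + b² + c² = 1`. -/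
theorem exists_pair_abs_add_ge_one {a b c : ℝ} (h : a ^ 2 + b ^ 2 + c ^ 2 = 1) :
    1 ≤ |a| + |b| ∨ 1 ≤ |a| + |c| ∨ 1 ≤ |b| + |c| := by
  by_contra hcon
  push Not at hcon
  obtain ⟨h1, h2, h3⟩ := hcon
  set x := |a| with hx
  set y := |b| with hy
  set z := |c| with hz
  have hx0 : 0 ≤ x := abs_nonneg a
  have hy0 : 0 ≤ y := abs_nonneg b
  have hz0 : 0 ≤ z := abs_nonneg c
  have hsum : x ^ 2 + y ^ 2 + z ^ 2 = 1 := by rw [hx, hy, hz, sq_abs, sq_abs, sq_abs]; exact h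
  -- `(x+y)² < 1 = x² + y² + z²` gives `2xy < z²`, and cyclically
  have e1 : (x + y) * (x + y) < 1 := by
    have := mul_self_lt_mul_self (by positivity : (0 : ℝ) ≤ x + y) h1; simpa using this
  have e2 : (x + z) * (x + z) < 1 := by
    have := mul_self_lt_mul_self (by positivity : (0 : ℝ) ≤ x + z) h2; simpa using this
  have e3 : (y + z) * (y + z) < 1 := by
    have := mul_self_lt_mul_self (by positivity : (0 : ℝ) ≤ y + z) h3; simpa using this
  have p1 : 2 * x * y < z ^ 2 := by linarith [show (x + y) * (x + y) = x ^ 2 + y ^ 2 + 2 * x * y by ring]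
  have p2 : 2 * x * z < y ^ 2 := by linarith [show (x + z) * (x + z) = x ^ 2 + z ^ 2 + 2 * x * z by ring]
  have p3 : 2 * y * z < x ^ 2 := by linarith [show (y + z) * (y + z) = y ^ 2 + z ^ 2 + 2 * y * z by ring]
  rcases eq_or_lt_of_le hz0 with hz1 | hzpos
  · rw [← hz1] at p1; nlinarith [mul_nonneg hx0 hy0]
  rcases eq_or_lt_of_le hy0 with hy1 | hypos
  · rw [← hy1] at p2; nlinarith [mul_nonneg hx0 hz0]
  rcases eq_or_lt_of_le hx0 with hx1 | hxpos
  · rw [← hx1] at p3; nlinarith [mul_nonneg hy0 hz0]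
  have hyz : 0 < y * z := mul_pos hypos hzpos
  have m : (2 * x * y) * (2 * x * z) < z ^ 2 * y ^ 2 := mul_lt_mul'' p1 p2 (by positivity) (by positivity)
  have m' : (4 * x ^ 2) * (y * z) < (y * z) * (y * z) := by nlinarith [m]
  have q : 4 * x ^ 2 < y * z := lt_of_mul_lt_mul_right m' hyz.le
  nlinarith [q, p3, sq_nonneg x]

/-- **Slot table**: for a coordinate pair `i < j` and signs `σ, τ ∈ {±1}` there is a slot with integer cubic coordinates `σ eᵢ + τ eⱼ`. -/
theorem exists_slotInt_pair : ∀ i j : Fin 3, i < j → ∀ σ τ : ℤ, (σ = 1 ∨ σ = -1) → (τ = 1 ∨ τ = -1) →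
    ∃ k : Fin 12, slotInt k = Pi.single i σ + Pi.single j τ := by
  intro i j hij σ τ hσ hτ
  rcases hσ with rfl | rfl <;> rcases hτ with rfl | rfl <;> revert i j <;> decide

/-- The integer normals have entries `±1`. -/
theorem nrm_apply_eq : ∀ (i : Fin 4) (l : Fin 3), nrm i l = 1 ∨ nrm i l = -1 := by decide

/-- A real number is `±` its absolute value with a sign `σ ∈ {±1}`. -/
private theorem exists_sign_mul_eq_abs' (a : ℝ) : ∃ σ : ℤ, (σ = 1 ∨ σ = -1) ∧ (σ : ℝ) * a = |a| := by
  rcases le_or_gt 0 a with h | h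
  · exact ⟨1, Or.inl rfl, by rw [abs_of_nonneg h]; push_cast; ring⟩
  · exact ⟨-1, Or.inr rfl, by rw [abs_of_neg h]; push_cast; ring⟩

/-! ### Cubic-coordinate bookkeeping -/

/-- `⟪slotSite k, nrmVec i⟫ = (Σ_l slotInt k l · nrm i l)/(√2·√3)`. -/
theorem inner_slotSite_nrmVec (k : Fin 12) (i : Fin 4) :
    ⟪slotSite k, nrmVec i⟫_ℝ = ((slotInt k 0 * nrm i 0 + slotInt k 1 * nrm i 1 + slotInt k 2 * nrm i 2 : ℤ) : ℝ) / (Real.sqrt 2 * Real.sqrt 3) := by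
  rw [inner_eq_cubicCoords, cubicCoords_slotSite, cubicCoords_nrmVec]
  simp only [dotProduct, Fin.sum_univ_three, slotVec, Pi.smul_apply, smul_eq_mul, nrmR]
  push_cast
  field_simp

/-- `⟪v, nrmVec i⟫ = (Σ_l (cubicCoords v)_l · nrm i l)/√3`. -/
theorem inner_nrmVec_eq (v : EuclideanSpace ℝ (Fin 3)) (i : Fin 4) :
    ⟪v, nrmVec i⟫_ℝ = (cubicCoords v 0 * nrm i 0 + cubicCoords v 1 * nrm i 1 + cubicCoords v 2 * nrm i 2) / Real.sqrt 3 := by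
  rw [inner_eq_cubicCoords, cubicCoords_nrmVec]
  simp only [dotProduct, Fin.sum_univ_three, Pi.smul_apply, smul_eq_mul, nrmR]
  field_simp

/-! ### The covering lemmas -/

/-- **COVERING ON THE NON-NEGATIVE SIDE OF A TWIN PLANE.**  For a unit `v` and a unit model menu normal `μ` (a `{111}` normal of `Λ₀`) with
`⟪v, μ⟫ ≥ 0` there is a slot `s` with `⟪s, μ⟫ ≥ 0` and `⟪v, s⟫ ≥ √2/2`. -/
theorem exists_slot_cover_nonneg {v μ : EuclideanSpace ℝ (Fin 3)} (hv : ‖v‖ = 1) (hμ : ‖μ‖ = 1)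
    (hmenu : ∀ w ∈ fccSlots, ⟪w, μ⟫_ℝ = 0 ∨ ⟪w, μ⟫_ℝ = Real.sqrt (2 / 3) ∨ ⟪w, μ⟫_ℝ = -Real.sqrt (2 / 3)) (hvμ : 0 ≤ ⟪v, μ⟫_ℝ) :
    ∃ s ∈ fccSlots, 0 ≤ ⟪s, μ⟫_ℝ ∧ Real.sqrt 2 / 2 ≤ ⟪v, s⟫_ℝ := by
  obtain ⟨i₀, hi₀⟩ := exists_nrmVec_of_menu hμ hmenu
  -- the sign `η` with `μ = η · nrmVec i₀`
  obtain ⟨η, hη, hμη⟩ : ∃ η : ℤ, (η = 1 ∨ η = -1) ∧ μ = (η : ℝ) • nrmVec i₀ := by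
    rcases hi₀ with h | h
    · exact ⟨1, Or.inl rfl, by rw [h]; simp⟩
    · exact ⟨-1, Or.inr rfl, by rw [h]; simp⟩
  set a := cubicCoords v with ha
  have hsum : a 0 ^ 2 + a 1 ^ 2 + a 2 ^ 2 = 1 := TailResidue.cubicCoords_sq_sum hv
  have hs2 : 0 < Real.sqrt 2 := by positivity
  have hs3 : 0 < Real.sqrt 3 := by positivity
  have hs22 : Real.sqrt 2 * Real.sqrt 2 = 2 := Real.mul_self_sqrt (by norm_num)
  -- integer sign vector of μ: `ε_l = η · nrm i₀ l ∈ {±1}`, and `⟪v, μ⟫·√3 = Σ ε_l a_l ≥ 0`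
  have hvμ' : 0 ≤ (η : ℝ) * (a 0 * nrm i₀ 0 + a 1 * nrm i₀ 1 + a 2 * nrm i₀ 2) := by
    have h1 : ⟪v, μ⟫_ℝ = (η : ℝ) * ((a 0 * nrm i₀ 0 + a 1 * nrm i₀ 1 + a 2 * nrm i₀ 2) / Real.sqrt 3) := by
      rw [hμη, inner_smul_right, inner_nrmVec_eq]
    rw [h1] at hvμ
    have : (η : ℝ) * (a 0 * nrm i₀ 0 + a 1 * nrm i₀ 1 + a 2 * nrm i₀ 2) = (η : ℝ) * ((a 0 * nrm i₀ 0 + a 1 * nrm i₀ 1 + a 2 * nrm i₀ 2) / Real.sqrt 3) * Real.sqrt 3 := by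
      field_simp
    rw [this]; exact mul_nonneg hvμ hs3.le
  -- generic step: a pair `(i, j)`, `i < j`, with `|a i| + |a j| ≥ 1` yields the slot
  have step : ∀ i j : Fin 3, i < j → ∀ l : Fin 3, l ≠ i → l ≠ j → (∀ f : Fin 3 → ℝ, f 0 + f 1 + f 2 = f i + f j + f l) →
      1 ≤ |a i| + |a j| → ∃ s ∈ fccSlots, 0 ≤ ⟪s, μ⟫_ℝ ∧ Real.sqrt 2 / 2 ≤ ⟪v, s⟫_ℝ := by
    intro i j hij l hli hlj hsum3 hge
    obtain ⟨σ, hσ, hσa⟩ := exists_sign_mul_eq_abs' (a i)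
    obtain ⟨τ, hτ, hτa⟩ := exists_sign_mul_eq_abs' (a j)
    obtain ⟨k, hk⟩ := exists_slotInt_pair i j hij σ τ hσ hτ
    have hij' : i ≠ j := ne_of_lt hij
    have hki : slotInt k i = σ := by
      rw [hk, Pi.add_apply, Pi.single_eq_same, Pi.single_eq_of_ne hij', add_zero]
    have hkj : slotInt k j = τ := by
      rw [hk, Pi.add_apply, Pi.single_eq_same, Pi.single_eq_of_ne hij'.symm, zero_add]
    have hkl : slotInt k l = 0 := by
      rw [hk, Pi.add_apply, Pi.single_eq_of_ne hli, Pi.single_eq_of_ne hlj, add_zero]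
    refine ⟨slotSite k, slotSite_mem k, ?_, ?_⟩
    · -- the sign condition: `σ ε_i + τ ε_j ≥ 0`, else `⟪v, μ⟫ ≥ 0` forces `a i = a j = 0`
      rw [hμη, inner_smul_right, inner_slotSite_nrmVec]
      have hI : (slotInt k 0 * nrm i₀ 0 + slotInt k 1 * nrm i₀ 1 + slotInt k 2 * nrm i₀ 2 : ℤ) = σ * nrm i₀ i + τ * nrm i₀ j := by
        have := hsum3 (fun t => ((slotInt k t * nrm i₀ t : ℤ) : ℝ))
        have h' : ((slotInt k 0 * nrm i₀ 0 + slotInt k 1 * nrm i₀ 1 + slotInt k 2 * nrm i₀ 2 : ℤ) : ℝ) = ((σ * nrm i₀ i + τ * nrm i₀ j : ℤ) : ℝ) := by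
          push_cast at this ⊢
          rw [this, hki, hkj, hkl]; push_cast; ring
        exact_mod_cast h'
      rw [hI]
      have hden : 0 < Real.sqrt 2 * Real.sqrt 3 := mul_pos hs2 hs3
      set M : ℤ := η * (σ * nrm i₀ i + τ * nrm i₀ j) with hM
      have hgoal : (η : ℝ) * (((σ * nrm i₀ i + τ * nrm i₀ j : ℤ) : ℝ) / (Real.sqrt 2 * Real.sqrt 3)) = (M : ℝ) / (Real.sqrt 2 * Real.sqrt 3) := by
        rw [hM]; push_cast; ring
      rw [hgoal]
      rcases le_or_gt 0 M with hM0 | hM0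
      · exact div_nonneg (by exact_mod_cast hM0) hden.le
      exfalso
      -- `M < 0` forces `η σ ε_i = -1` and `η τ ε_j = -1`
      have hprod : (η * σ * nrm i₀ i : ℤ) = -1 ∧ (η * τ * nrm i₀ j : ℤ) = -1 := by
        rw [hM] at hM0
        rcases hη with rfl | rfl <;> rcases hσ with rfl | rfl <;> rcases hτ with rfl | rfl <;>
          rcases nrm_apply_eq i₀ i with h1 | h1 <;> rcases nrm_apply_eq i₀ j with h2 | h2 <;>
            simp only [h1, h2] at hM0 ⊢ <;> omega
      -- then `η √3 ⟪v, μ⟫ = -|a i| - |a j| ± a l ≥ 0` forces `|a l| ≥ 1`: contradiction with the unit norm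
      have hexp : (η : ℝ) * (a 0 * nrm i₀ 0 + a 1 * nrm i₀ 1 + a 2 * nrm i₀ 2) =
          (η * nrm i₀ i : ℤ) * a i + (η * nrm i₀ j : ℤ) * a j + (η * nrm i₀ l : ℤ) * a l := by
        rw [hsum3 (fun t => a t * nrm i₀ t)]; push_cast; ring
      have h1 : ((η * nrm i₀ i : ℤ) : ℝ) * a i = -|a i| := by
        have : (η * nrm i₀ i : ℤ) = -σ := by
          rcases hσ with rfl | rfl <;> [linarith [hprod.1]; linarith [hprod.1]]
        rw [this, ← hσa]; push_cast; ring
      have h2 : ((η * nrm i₀ j : ℤ) : ℝ) * a j = -|a j| := by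
        have : (η * nrm i₀ j : ℤ) = -τ := by
          rcases hτ with rfl | rfl <;> [linarith [hprod.2]; linarith [hprod.2]]
        rw [this, ← hτa]; push_cast; ring
      have h3 : ((η * nrm i₀ l : ℤ) : ℝ) * a l ≤ |a l| := by
        have hε : (η * nrm i₀ l : ℤ) = 1 ∨ (η * nrm i₀ l : ℤ) = -1 := by
          rcases hη with rfl | rfl <;> rcases nrm_apply_eq i₀ l with h | h <;> simp [h]
        rcases hε with h | h <;> rw [h] <;> push_cast
        · rw [one_mul]; exact le_abs_self _
        · rw [neg_one_mul]; exact neg_le_abs _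
      rw [hexp, h1, h2] at hvμ'
      have hl1 : 1 ≤ |a l| := by linarith
      have hsuml : a i ^ 2 + a j ^ 2 + a l ^ 2 = 1 := by rw [← hsum3 (fun t => a t ^ 2)]; exact hsum
      nlinarith [sq_abs (a l), sq_abs (a i), sq_abs (a j), abs_nonneg (a i), abs_nonneg (a j), sq_nonneg (|a i| + |a j|)]
    · -- the covering inequality
      rw [inner_slotSite_right, hsum3 (fun t => a t * slotInt k t)]
      rw [hki, hkj, hkl]
      push_cast
      rw [le_div_iff₀ hs2]
      nlinarith [hσa, hτa, hs22]
  rcases exists_pair_abs_add_ge_one hsum with h | h | h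
  · exact step 0 1 (by decide) 2 (by decide) (by decide) (fun f => by ring) h
  · exact step 0 2 (by decide) 1 (by decide) (by decide) (fun f => by ring) h
  · exact step 1 2 (by decide) 0 (by decide) (by decide) (fun f => by ring) h

/-- The basal axis `e₃` is a model menu normal. -/
theorem menu_e₃ : ∀ w ∈ fccSlots, ⟪w, EuclideanSpace.single (2 : Fin 3) (1 : ℝ)⟫_ℝ = 0 ∨
    ⟪w, EuclideanSpace.single (2 : Fin 3) (1 : ℝ)⟫_ℝ = Real.sqrt (2 / 3) ∨ ⟪w, EuclideanSpace.single (2 : Fin 3) (1 : ℝ)⟫_ℝ = -Real.sqrt (2 / 3) := by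
  intro w hw
  rw [EuclideanSpace.inner_single_right]
  simp only [one_mul]
  rw [fccSlots, mem_image] at hw
  obtain ⟨c, hc, rfl⟩ := hw
  rw [Literature.MathematicalPhysics.StatisticalMechanics.barlowPos_apply_two]
  simp only [fccSlotTriples, mem_insert, mem_singleton] at hc
  rcases hc with rfl | rfl | rfl | rfl | rfl | rfl | rfl | rfl | rfl | rfl | rfl | rfl <;> simp

/-- **COVERING.**  Every unit vector is within 45° of a slot: `∃ s ∈ fccSlots, ⟪v, s⟫ ≥ √2/2`. -/
theorem exists_slot_cover {v : EuclideanSpace ℝ (Fin 3)} (hv : ‖v‖ = 1) : ∃ s ∈ fccSlots, Real.sqrt 2 / 2 ≤ ⟪v, s⟫_ℝ := by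
  have he : ‖(EuclideanSpace.single (2 : Fin 3) (1 : ℝ))‖ = 1 := by rw [PiLp.norm_single, norm_one]
  rcases le_or_gt 0 ⟪v, EuclideanSpace.single (2 : Fin 3) (1 : ℝ)⟫_ℝ with h | h
  · obtain ⟨s, hs, -, hcov⟩ := exists_slot_cover_nonneg hv he menu_e₃ h
    exact ⟨s, hs, hcov⟩
  · have he' : ‖-(EuclideanSpace.single (2 : Fin 3) (1 : ℝ))‖ = 1 := by rw [norm_neg, he]
    have hmenu' : ∀ w ∈ fccSlots, ⟪w, -EuclideanSpace.single (2 : Fin 3) (1 : ℝ)⟫_ℝ = 0 ∨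
        ⟪w, -EuclideanSpace.single (2 : Fin 3) (1 : ℝ)⟫_ℝ = Real.sqrt (2 / 3) ∨
        ⟪w, -EuclideanSpace.single (2 : Fin 3) (1 : ℝ)⟫_ℝ = -Real.sqrt (2 / 3) := by
      intro w hw
      rw [inner_neg_right]
      rcases menu_e₃ w hw with h1 | h1 | h1 <;> rw [h1]
      · exact Or.inl neg_zero
      · exact Or.inr (Or.inr rfl)
      · exact Or.inr (Or.inl (neg_neg _))
    obtain ⟨s, hs, -, hcov⟩ := exists_slot_cover_nonneg hv he' hmenu' (by rw [inner_neg_right]; linarith)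
    exact ⟨s, hs, hcov⟩

end Summit.Ventures.Crystal3D.Theorems

end
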